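import Summits.HubbardSuperconductivity.HubbardSuperconductivity.Theorems.KLProgrammeKLRegimeScaleZeroCovarianceFarL2ImagesLowShell

/-!
# Route `KLProgramme`, crux K3 — engine-flow child (stmt-HubbardSuperconductivity-20437), stub (C) at `n = 0`, located item #22a «(C)-SCALE0-PT2»,
# the FAR-SITE supplier, LOW shell: THE IMAGES TERM AT THE ENGINE'S THRESHOLDS IS `≤ 10⁻¹⁰` (so `Dlow k := (√(D k) + 10⁻¹⁰)²`)

Cell gate-hubbard-kl, seat p1 g22 (supplier).  `…FarL2ImagesLowShell.l2Far_low_envelope_of_farLattice` delivers the closer's `hlow` with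
`Dlow k := (√(D k) + √(L^{k+2})·C₄^u·(4/L)⁴·S₄)²` at images order `K = 4`, `C₄^u = 4!·klChi2CauchyTab 4·5!·(4/klE0)⁵·(8π)⁴/π⁴ = 24·509100·120·128⁵·4096 ≈ 2.06·10²³`,
`S₄ ≤ 9` (`tsum_inv_one_add_norm_pow_le_nine`).  At the engine's volume threshold the images summand is negligible:
* §1 `klEngL₃_ge_of_le` — `klBetaMin ≤ β`, `0 < U ≤ 2⁻²⁰` ⇒ `2¹⁰·129²·(2²⁰+1)² ≤ klEngL₃ β U` (so `L ≥ 1.87·10¹⁹`);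
* §2 **`imagesTerm_le_of_klEngL₃`** — for `k : Fin 3`, `klBetaMin ≤ β`, `0 < U ≤ 2⁻²⁰`, `klEngL₃ β U ≤ L`:
  `√(L^{k+2})·C₄^u·(4/L)⁴·S₄ ≤ 10⁻¹⁰` (`√(L^{k+2}) ≤ L²`, `(4/L)⁴ = 256/L⁴`, `2304·C₄^u ≈ 4.75·10²⁶ ≤ 10⁻¹⁰·L²`);
* §3 **`l2Far_low_envelope_of_farLattice_klEng`** — the closer's `hlow` with **`Dlow k := (√(D k) + 10⁻¹⁰)²`** under the engine thresholds
  (the regime `U ≤ klEngU₀12 ≤ klTailBookU` is far inside `U ≤ 2⁻²⁰`).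

No definitions; nothing here asserts (C), any stub of 20437, K3 or superconductivity; `D k` is the kit-certified far lattice sum (a HYPOTHESIS).
References: BGM 2006 §3 (3.2) [cite: BenfattoGiulianiMastropietro2006].
-/

noncomputable section

namespace Summit.HubbardSuperconductivity.HubbardSuperconductivity.Theorems.KLRegimeSplit

set_option linter.dupNamespace false -- summit = problem name (single-conjunct summit), D-0017

open Literature.MathematicalPhysics.QuantumLattice Literature.Probability.LatticeModels Literature.Analysis.FunctionSpaces
open Summit.HubbardSuperconductivity.HubbardSuperconductivity.Theorems.DispersionFlow
open Summit.HubbardSuperconductivity.HubbardSuperconductivity.Theorems.EngineV8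
open MeasureTheory Finset Complex UnitAddTorus Real
open scoped Nat

variable {L : ℕ} [NeZero L]

/-! ## §1 The volume threshold in numbers -/

omit [NeZero L] in
/-- **`klEngL₃ β U ≥ 2¹⁰·129²·(2²⁰+1)²`** for `klBetaMin ≤ β` and `0 < U ≤ 2⁻²⁰` (`⌈β⌉₊ ≥ 128`, `⌈U⁻¹⌉₊ ≥ 2²⁰`). -/
theorem klEngL₃_ge_of_le {β U : ℝ} (hβ : klBetaMin ≤ β) (hU0 : 0 < U) (hU : U ≤ (2 : ℝ)⁻¹ ^ 20) :
    2 ^ 10 * 129 ^ 2 * (2 ^ 20 + 1) ^ 2 ≤ klEngL₃ β U := by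
  have hβ128 : (128 : ℝ) ≤ β := by have : klBetaMin = 128 := rfl; rw [← this]; exact hβ
  have hβabs : |β| = β := abs_of_pos (by linarith)
  have hUabs : |U| = U := abs_of_pos hU0
  have h1 : 128 ≤ ⌈|β|⌉₊ := by
    rw [hβabs]
    have := Nat.le_ceil β
    have h : (128 : ℝ) ≤ (⌈β⌉₊ : ℝ) := hβ128.trans this
    exact_mod_cast h
  have h2 : 2 ^ 20 ≤ ⌈|U|⁻¹⌉₊ := by
    rw [hUabs]
    have hinv : (2 : ℝ) ^ 20 ≤ U⁻¹ := by
      rw [inv_pow] at hU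
      have := (le_inv_comm₀ hU0 (by positivity)).1 hU
      simpa using this
    have h : ((2 : ℝ) ^ 20) ≤ (⌈U⁻¹⌉₊ : ℝ) := hinv.trans (Nat.le_ceil _)
    exact_mod_cast h
  unfold klEngL₃
  have h1' : 129 ≤ ⌈|β|⌉₊ + 1 := by omega
  have h2' : 2 ^ 20 + 1 ≤ ⌈|U|⁻¹⌉₊ + 1 := by omega
  exact Nat.mul_le_mul (Nat.mul_le_mul_left _ (Nat.pow_le_pow_left h1' 2)) (Nat.pow_le_pow_left h2' 2)

/-! ## §2 The images term at `K = 4` under the volume threshold -/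

omit [NeZero L] in
/-- **THE IMAGES TERM IS `≤ 10⁻¹⁰` AT THE ENGINE'S THRESHOLDS**: for `k : Fin 3`, `klBetaMin ≤ β`, `0 < U ≤ 2⁻²⁰`, `klEngL₃ β U ≤ L`,
`√(L^{k+2})·(4!·(klChi2CauchyTab 4·5!·(4/klE0)²·(4/klE0)³)·(8π)⁴/π⁴)·(4/L)⁴·Σ_n(1+‖n‖∞)⁻⁴ ≤ 10⁻¹⁰`. -/
theorem imagesTerm_le_of_klEngL₃ (k : Fin 3) {β U : ℝ} (hβ : klBetaMin ≤ β) (hU0 : 0 < U) (hU : U ≤ (2 : ℝ)⁻¹ ^ 20)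
    (hL : klEngL₃ β U ≤ L) :
    Real.sqrt ((L : ℝ) ^ ((k : ℕ) + 2)) *
        (((4 : ℕ) ! * (klChi2CauchyTab 4 * ((4 : ℕ) + 1)! * (4 / klE0) ^ 2 * (4 / klE0) ^ (4 - 1)) * ((2 * π) * 4) ^ 4) / Real.pi ^ 4 *
          (4 / (L : ℝ)) ^ 4 * ∑' n : Site 2, ((1 + ‖n‖) ^ 4)⁻¹) ≤ (10 : ℝ)⁻¹ ^ 10 := by
  -- the volume in numbers
  have hL₀ : (2 : ℝ) ^ 10 * 129 ^ 2 * (2 ^ 20 + 1) ^ 2 ≤ (L : ℝ) := by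
    have h := (klEngL₃_ge_of_le hβ hU0 hU).trans hL
    exact_mod_cast h
  have hL1 : (1 : ℝ) ≤ L := le_trans (by norm_num) hL₀
  have hLpos : (0 : ℝ) < L := by linarith
  -- constants
  have hTab : klChi2CauchyTab 4 = 509100 := by norm_num [klChi2CauchyTab]
  have hE0 : klE0 = 1 / 32 := rfl
  have hS := tsum_inv_one_add_norm_pow_le_nine (le_refl 4)
  have hS0 : 0 ≤ ∑' n : Site 2, ((1 + ‖n‖) ^ 4)⁻¹ := tsum_nonneg fun n => by positivity
  have hπ : Real.pi ≠ 0 := Real.pi_pos.ne'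
  have hC : ((4 : ℕ) ! * (klChi2CauchyTab 4 * ((4 : ℕ) + 1)! * (4 / klE0) ^ 2 * (4 / klE0) ^ (4 - 1)) * ((2 * π) * 4) ^ 4) / Real.pi ^ 4 =
      24 * (509100 * 120 * 128 ^ 5) * 4096 := by
    rw [hTab, hE0]
    simp only [Nat.factorial, Nat.succ_eq_add_one]
    field_simp
    ring
  rw [hC]
  -- `√(L^{k+2}) ≤ L²`
  have hsqrt : Real.sqrt ((L : ℝ) ^ ((k : ℕ) + 2)) ≤ (L : ℝ) ^ 2 := by
    have hk : (k : ℕ) + 2 ≤ 4 := by have := k.isLt; omega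
    rw [show (L : ℝ) ^ 2 = Real.sqrt (((L : ℝ) ^ 2) ^ 2) by rw [Real.sqrt_sq (by positivity)]]
    refine Real.sqrt_le_sqrt ?_
    rw [← pow_mul]
    exact pow_le_pow_right₀ hL1 (by omega)
  -- assemble: `≤ L²·C·256/L⁴·9 = 2304 C / L²`
  have h4L : (4 / (L : ℝ)) ^ 4 = 256 / (L : ℝ) ^ 4 := by rw [div_pow]; norm_num
  rw [h4L]
  calc Real.sqrt ((L : ℝ) ^ ((k : ℕ) + 2)) * ((24 * (509100 * 120 * 128 ^ 5) * 4096 : ℝ) * (256 / (L : ℝ) ^ 4) * ∑' n : Site 2, ((1 + ‖n‖) ^ 4)⁻¹)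
      ≤ (L : ℝ) ^ 2 * ((24 * (509100 * 120 * 128 ^ 5) * 4096 : ℝ) * (256 / (L : ℝ) ^ 4) * 9) := by
        refine mul_le_mul hsqrt (mul_le_mul_of_nonneg_left hS (by positivity)) (by positivity) (by positivity)
    _ = (24 * (509100 * 120 * 128 ^ 5) * 4096 * 256 * 9 : ℝ) / (L : ℝ) ^ 2 := by
        field_simp
    _ ≤ (24 * (509100 * 120 * 128 ^ 5) * 4096 * 256 * 9 : ℝ) / ((2 : ℝ) ^ 10 * 129 ^ 2 * (2 ^ 20 + 1) ^ 2) ^ 2 := by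
        refine div_le_div_of_nonneg_left (by positivity) (by positivity) ?_
        exact pow_le_pow_left₀ (by positivity) hL₀ 2
    _ ≤ (10 : ℝ)⁻¹ ^ 10 := by norm_num

/-! ## §3 The closer's `hlow` under the engine thresholds -/

/-- **THE `hlow` OF THE TWO-SHELLS CLOSER UNDER THE ENGINE THRESHOLDS** (`klBetaMin ≤ β`, `0 < U ≤ 2⁻²⁰`, `klEngL₃ β U ≤ L`): if for every row `k`
ONE number `D k` bounds the row-`k` far lattice sum of the infinite-volume kernel at every low-shell Matsubara frequency, then the low-shell envelope
**`Dlow k := (√(D k) + 10⁻¹⁰)²`** works. -/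
theorem l2Far_low_envelope_of_farLattice_klEng {M : ℕ} (μ : ℝ) {β U : ℝ} (hβ : klBetaMin ≤ β) (hU0 : 0 < U) (hU : U ≤ (2 : ℝ)⁻¹ ^ 20)
    (hL : klEngL₃ β U ≤ L) (ω₁ : ℝ) (c : SunsetCellRecordV2) {D : Fin 3 → ℝ}
    (hD : ∀ (k : Fin 3) (i : MatsubaraIdx M), |matsubaraFreq β M i| < ω₁ →
      ∑' z : Site 2, (if z ≠ 0 ∧ z ∉ c.disk then Real.sqrt ((((z 0 : ℤ) : ℝ)) ^ 2 + (((z 1 : ℤ) : ℝ)) ^ 2) ^ (k : ℕ) else 0) *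
        ‖mFourierCoeff (Torus.descend (fun y : Momentum => uvSymbolFn 1 klE0 (frameLevel μ 0 ((2 * π) • y)) (matsubaraFreq β M i))
          (uvSpatialSymbol_isLatticePeriodic 1 klE0 μ 0 (matsubaraFreq β M i))) (-z)‖ ^ 2 ≤ D k) :
    ∀ (k : Fin 3) (i : MatsubaraIdx M), |matsubaraFreq β M i| < ω₁ →
      ∑ u : TorusSite 2 L,
        (if u ≠ 0 ∧ (fun j => (u j).valMinAbs : Site 2) ∉ c.disk then
          Real.sqrt ((((u 0).valMinAbs.natAbs : ℝ)) ^ 2 + (((u 1).valMinAbs.natAbs : ℝ)) ^ 2) ^ (k : ℕ) *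
            ‖torusFourierInv (fun kv : TorusSite 2 L =>
              (fun y : Momentum => uvSymbolFn 1 klE0 (frameLevel μ 0 ((2 * π) • y)) (matsubaraFreq β M i))
                (WithLp.toLp 2 fun j => ((kv j).val : ℝ) / L)) u‖ ^ 2
          else 0) ≤
      (Real.sqrt (D k) + (10 : ℝ)⁻¹ ^ 10) ^ 2 := by
  have hβ₀ : (0 : ℝ) < klBetaMin := by norm_num [klBetaMin]
  have hβpos : 0 < β := lt_of_lt_of_le hβ₀ hβ
  intro k i hi
  have h := l2Far_low_envelope_of_farLattice (L := L) μ hβpos ω₁ c hD (le_refl (2 * 2)) k i hi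
  have h4 : (2 * 2 : ℕ) = 4 := rfl
  simp only [h4] at h
  have himg := imagesTerm_le_of_klEngL₃ (L := L) k hβ hU0 hU hL
  have hT := one_le_klChi2CauchyTab 4
  have hS0 : 0 ≤ ∑' n : Site 2, ((1 + ‖n‖) ^ 4)⁻¹ := tsum_nonneg fun n => by positivity
  have hE0 : (0 : ℝ) < klE0 := by norm_num [klE0]
  have h0 : 0 ≤ Real.sqrt (D k) + Real.sqrt ((L : ℝ) ^ ((k : ℕ) + 2)) *
      (((4 : ℕ) ! * (klChi2CauchyTab 4 * ((4 : ℕ) + 1)! * (4 / klE0) ^ 2 * (4 / klE0) ^ (4 - 1)) * ((2 * π) * 4) ^ 4) / Real.pi ^ 4 *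
        (4 / (L : ℝ)) ^ 4 * ∑' n : Site 2, ((1 + ‖n‖) ^ 4)⁻¹) := by positivity
  exact h.trans (pow_le_pow_left₀ h0 (add_le_add le_rfl himg) 2)

end Summit.HubbardSuperconductivity.HubbardSuperconductivity.Theorems.KLRegimeSplit

end
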